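import Summits.BirchSwinnertonDyer.BirchSwinnertonDyer.Theorems.PrintCFramBottomClassIndexLawFiveLeHerbrandOddUnramifiedHCF
import Literature.NumberTheory.NumberFields.ClassGroupUnitsGaloisModules
import Literature.NumberTheory.NumberFields.ClassGroupPrimesAvoiding
import Literature.NumberTheory.GaloisRepresentations.AbsGaloisOuterConj
import HarnessLib

/-!
# Route `PrintCFram`, crux C2 `BottomClassIndexLawFiveLe` (stmt-BirchSwinnertonDyer-20372), line
# `eisenstein-resource-bdp-line` (LEAD g9, Road C, stub O): EQUIVARIANCE TRANSPORT — a character of `Γ_L` that is an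
# eigenvector for the outer action of `Γ_ℚ` descends to an EIGEN-homomorphism on `Cl(L)` for the Galois action on classes
# (cell `bsd-print-cfram`, seat `bsd-line-cfram-p1-w6` g0; helper `--supports` 20372; 0 facts, 0 defs)

HONEST FRAMING. Nothing about BSD is proved here; no summit statement is proved by this seat. Sequel of
`…HerbrandOddUnramifiedHCF` (an everywhere-unramified `κ : Γ_L → A` is `g ∘ artinEquiv⁻¹ ∘ (Γ_L → Gal(H/L))` for a
`g : Cl(𝓞 L) →* A`). Stub O's hypothesis is an EIGEN-condition under `Γ_ℚ`-conjugation: `κ(γ σ γ⁻¹) = κ(σ)^{e(γ)}` — in the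
tree's currency the outer action `absGaloisOuterConj ℚ L γ : Γ_L → Γ_L` (`res(θ_γ σ) = γ res(σ) γ⁻¹`). This file transports it
to the class group: **`g(γ̄ · c) = g(c)^{e(γ)}` for every class `c`**, `γ̄ = absGaloisQuot ℚ L γ ∈ Gal(L/ℚ)` acting on `Cl(𝓞 L)`
through `ClassGroup.mulEquiv (AmbiguousClass.intAut γ̄)` (= the tree's `classGroupRep`). Mechanism (no Chebotarev): prime classes
generate `Cl` (`ClassGroup.closure_mk0_prime_not_mem_eq_top`), `κ(Frob_𝔔) = g([w])` (`apply_eq_classGroup_mk0_of_isArithFrobAt`),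
and `θ_γ` carries a Frobenius at `𝔔 ∣ w` to a Frobenius at `γ ⋆ 𝔔 ∣ γ̄ • w` (`isArithFrobAt_absGaloisOuterConj_iff`,
`outerConjIdeal_mem_primesAbove`), while `[γ̄ • w] = γ̄ · [w]` (`mulEquiv_mk0_prime_eq`). With the odd class-group consumer
files (`…HerbrandOddClassGroup*`) this is the class-group half of stub O; the remaining wrapper only matches LEAD g9's v12
signature.

THEOREMS ONLY; no definition, no named fact, no `sorry`; imports no `Theses` module.
References: [NeukirchANT1999] Ch. I §9 (9.5), Ch. VI §7 (7.1); [Cox2013] §8.A Thm. 8.10.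
-/

set_option autoImplicit false
-- `…BirchSwinnertonDyer.BirchSwinnertonDyer.Theorems…` is the problem's mandated namespace (D-0017).
set_option linter.dupNamespace false

noncomputable section

open NumberField Field IsDedekindDomain
open Literature.NumberTheory.GaloisRepresentations Literature.NumberTheory.NumberFields
open scoped Pointwise nonZeroDivisors

namespace Summit.BirchSwinnertonDyer.BirchSwinnertonDyer.Theorems.PrintCFram.HerbrandOddClassGroup

variable {L : Type} [Field L] [NumberField L]

/-- The Galois action on places and the Galois action on classes agree on prime classes:
`σ · [𝔭_w] = [𝔭_{σ • w}]` (`ClassGroup.mulEquiv (intAut σ)` vs. the action on `HeightOneSpectrum (𝓞 L)`).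
[cite: NeukirchANT1999, Ch. I §9 (the action of the Galois group on primes)] -/
theorem mulEquiv_mk0_prime_eq {F : Type*} [Field F] [Algebra F L] (σ : L ≃ₐ[F] L) (w : HeightOneSpectrum (𝓞 L)) :
    ClassGroup.mulEquiv (AmbiguousClass.intAut σ) (ClassGroup.mk0 ⟨w.asIdeal, asIdeal_mem_nonZeroDivisors w⟩) =
      ClassGroup.mk0 ⟨(σ • w).asIdeal, asIdeal_mem_nonZeroDivisors (σ • w)⟩ := by
  rw [AmbiguousClass.mulEquiv_mk0]
  congr 1

variable [IsGalois ℚ L] {A : Type*} [CommGroup A]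

/-- **Equivariance transport to the class group.** Let `κ : Γ_L → A` factor through the class group as in
`exists_factor_classGroup_of_unramified` (`κ τ = g(artinEquiv⁻¹(τ|_H))`), and let `γ ∈ Γ_ℚ` act on `κ` as an eigen-operator:
`κ(θ_γ σ) = κ(σ)^e` for all `σ ∈ Γ_L` (`θ_γ = absGaloisOuterConj ℚ L γ`). Then `g(γ̄ · c) = g(c)^e` for every class `c`,
`γ̄ = absGaloisQuot ℚ L γ`. [cite: NeukirchANT1999, Ch. I §9 Prop. (9.5) and Ch. VI §7 Thm. (7.1)] -/
theorem classGroupHom_mulEquiv_eq_pow {κ : absoluteGaloisGroup L →* A} {g : ClassGroup (𝓞 L) →* A}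
    (hg : ∀ τ : absoluteGaloisGroup L,
      κ τ = g ((hilbertClassField.artinEquiv L).symm (absRestrictNormalHom (hilbertClassField L) τ)))
    (γ : absoluteGaloisGroup ℚ) (e : ℤ)
    (heq : ∀ σ : absoluteGaloisGroup L, κ (absGaloisOuterConj ℚ L γ σ) = (κ σ) ^ e)
    (c : ClassGroup (𝓞 L)) :
    g (ClassGroup.mulEquiv (AmbiguousClass.intAut (absGaloisQuot ℚ L γ)) c) = (g c) ^ e := by
  classical
  -- both sides are homomorphisms in `c`; compare them on the prime classes, which generate `Cl`
  set φ₁ : ClassGroup (𝓞 L) →* A :=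
    g.comp (ClassGroup.mulEquiv (AmbiguousClass.intAut (absGaloisQuot ℚ L γ))).toMonoidHom with hφ₁
  set φ₂ : ClassGroup (𝓞 L) →* A := (zpowGroupHom e).comp g with hφ₂
  suffices h : φ₁ = φ₂ by
    have := DFunLike.congr_fun h c
    simpa [hφ₁, hφ₂] using this
  refine MonoidHom.eq_of_eqOn_dense (ClassGroup.closure_mk0_prime_not_mem_eq_top (R := 𝓞 L) ∅) ?_
  rintro _ ⟨w, -, rfl⟩
  -- a Frobenius at a prime `𝔔 ∣ w` of `\bar ℤ_L`
  obtain ⟨𝔔, h𝔔⟩ := HeightOneSpectrum.primesAbove_nonempty w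
  obtain ⟨σ, hσ⟩ := HeightOneSpectrum.exists_isArithFrobAt_of_mem_primesAbove_holds (K := L) (v := w) h𝔔
  -- `θ_γ σ` is a Frobenius at `γ ⋆ 𝔔 ∣ γ̄ • w`
  have hσ' : IsArithFrobAt (𝓞 L) (absGaloisOuterConj ℚ L γ σ) (outerConjIdeal γ 𝔔) :=
    (isArithFrobAt_absGaloisOuterConj_iff h𝔔 γ σ).mpr hσ
  have h𝔔' := outerConjIdeal_mem_primesAbove h𝔔 γ
  have h1 : κ σ = g (ClassGroup.mk0 ⟨w.asIdeal, asIdeal_mem_nonZeroDivisors w⟩) :=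
    apply_eq_classGroup_mk0_of_isArithFrobAt L hg h𝔔 hσ
  have h2 : κ (absGaloisOuterConj ℚ L γ σ) =
      g (ClassGroup.mk0 ⟨(absGaloisQuot ℚ L γ • w).asIdeal, asIdeal_mem_nonZeroDivisors _⟩) :=
    apply_eq_classGroup_mk0_of_isArithFrobAt L hg h𝔔' hσ'
  have hw : ClassGroup.mk0 ⟨w.asIdeal, mem_nonZeroDivisors_iff_ne_zero.mpr w.ne_bot⟩ =
      ClassGroup.mk0 ⟨w.asIdeal, asIdeal_mem_nonZeroDivisors w⟩ := rfl
  simp only [hφ₁, hφ₂, MonoidHom.comp_apply, MulEquiv.coe_toMonoidHom, zpowGroupHom_apply, hw]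
  rw [mulEquiv_mk0_prime_eq, ← h2, heq σ, h1]

/-- Additive-exponent form for a character `r : Γ_ℚ → (ℤ/p)ˣ` acting on an `𝔽_p`-valued `κ` (`A = Multiplicative (ZMod p)`):
if `κ(θ_γ σ) = κ(σ)^{(r γ).val}` for all `σ`, then `g(γ̄ · c) = g(c)^{(r γ).val}` — the shape of stub O's «`G(γ n γ⁻¹) = r(γ)·G(n)`».
[cite: NeukirchANT1999, Ch. I §9 Prop. (9.5) and Ch. VI §7 Thm. (7.1)] -/
theorem classGroupHom_mulEquiv_eq_pow_val {p : ℕ} {κ : absoluteGaloisGroup L →* Multiplicative (ZMod p)}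
    {g : ClassGroup (𝓞 L) →* Multiplicative (ZMod p)}
    (hg : ∀ τ : absoluteGaloisGroup L,
      κ τ = g ((hilbertClassField.artinEquiv L).symm (absRestrictNormalHom (hilbertClassField L) τ)))
    (r : absoluteGaloisGroup ℚ →* (ZMod p)ˣ)
    (heq : ∀ (γ : absoluteGaloisGroup ℚ) (σ : absoluteGaloisGroup L),
      κ (absGaloisOuterConj ℚ L γ σ) = (κ σ) ^ ((r γ : ZMod p).val))
    (γ : absoluteGaloisGroup ℚ) (c : ClassGroup (𝓞 L)) :
    g (ClassGroup.mulEquiv (AmbiguousClass.intAut (absGaloisQuot ℚ L γ)) c) = (g c) ^ ((r γ : ZMod p).val) := by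
  have h := classGroupHom_mulEquiv_eq_pow hg γ (((r γ : ZMod p).val : ℕ) : ℤ) (fun σ => by
    rw [zpow_natCast]; exact heq γ σ) c
  rwa [zpow_natCast] at h

end Summit.BirchSwinnertonDyer.BirchSwinnertonDyer.Theorems.PrintCFram.HerbrandOddClassGroup

end
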